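import Literature.AlgebraicGeometry.HyperbolicPolynomials.HyperbolicityCone
import HarnessLib

/-!
# The Lorentz (second-order) cone as a hyperbolicity cone

Topic `Literature/AlgebraicGeometry/HyperbolicPolynomials`. The second of the three standard examples
(orthant `∏ zᵢ` — `HyperbolicityCone.lean`; Lorentz cone — here; positive definite cone —
`DeterminantalPencil.lean`), as printed by Borcea–Brändén–Liggett (J. Amer. Math. Soc. 22 (2009), §4.1,
example (II) after Prop. 4.4):

> (II) The (principal) symbol of the hyperbolic wave equation, i.e., the polynomial
> `p(z_1, …, z_n) = z_1² − Σ_{j=2}^n z_j²` is hyperbolic with respect to the direction `e = (1, 0, …, 0)`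
> and the hyperbolicity cone is the Lorentz cone `C_e(p) = {z ∈ ℝⁿ : √(z_2² + ⋯ + z_n²) ≤ z_1}`.

(Güler 1997, §2: "Its hyperbolicity cone is the Lorentz cone".) With the tree's conventions the *open*
cone `openHyperbolicityCone = C_e(p) = {x | p(x + te) ≠ 0 ∀ t ≥ 0}` is the *open* Lorentz cone
`{√(Σ z_j²) < z_1}` (a boundary point `√(Σ z_j²) = z_1` is a zero of `p`), and the printed set with `≤` is the
closed cone `hyperbolicityCone = Λ₊` (`t > 0`); we prove both descriptions. Variables are indexed by
`Option σ`, the time-like variable being `z₀ = X none`, the direction `e = Pi.single none 1`.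

## Main results (namespace `Literature.AlgebraicGeometry.HyperbolicPolynomials`)

* `lorentzForm σ = X none ^ 2 − Σᵢ X (some i) ^ 2` (definition with body), `eval_lorentzForm`,
  `isHomogeneous_lorentzForm`.
* `isHyperbolic_lorentzForm` — hyperbolic w.r.t. `e₀` (the zeros of `t ↦ (x₀ + t)² − Σ xᵢ²` are
  `−x₀ ± √(Σ xᵢ²)`).
* `openHyperbolicityCone_lorentzForm` — `Λ₊₊ = {x | √(Σ xᵢ²) < x₀}`;
  `hyperbolicityCone_lorentzForm` — `Λ₊ = {x | √(Σ xᵢ²) ≤ x₀}` (as printed).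

## References

* [BorceaBrandenLiggett2007] J. Borcea, P. Brändén, T. M. Liggett, *Negative dependence and the geometry
  of polynomials*, J. Amer. Math. Soc. 22 (2009) 521–567 (arXiv:0707.2340): §4.1, example (II) after
  Prop. 4.4 (PDF p. 15).
* [Guler1997] O. Güler, *Hyperbolic polynomials and interior point methods for convex programming*, Math.
  Oper. Res. 22 (1997) 350–377: §2 (the Lorentz cone example).
-/

noncomputable section

open MvPolynomial

namespace Literature.AlgebraicGeometry.HyperbolicPolynomials

variable (σ : Type*) [Fintype σ] [DecidableEq σ]

/-- **The Lorentz form** `p = z₀² − Σᵢ zᵢ²` in the variables `Option σ` (`z₀ = X none`), the principal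
symbol of the wave operator. [cite: BorceaBrandenLiggett2007, §4.1 example (II)] -/
def lorentzForm : MvPolynomial (Option σ) ℝ :=
  X none ^ 2 - ∑ i, X (some i) ^ 2

variable {σ}

omit [DecidableEq σ] in
/-- `p(w) = w₀² − Σᵢ wᵢ²`. [cite: BorceaBrandenLiggett2007, §4.1 example (II)] -/
theorem eval_lorentzForm (w : Option σ → ℝ) :
    eval w (lorentzForm σ) = w none ^ 2 - ∑ i, w (some i) ^ 2 := by
  simp [lorentzForm, map_sum]

omit [DecidableEq σ] in
/-- `p` is a quadratic form. [cite: BorceaBrandenLiggett2007, §4.1 example (II)] -/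
theorem isHomogeneous_lorentzForm : (lorentzForm σ).IsHomogeneous 2 :=
  ((isHomogeneous_X ℝ none).pow 2).sub
    (IsHomogeneous.sum _ _ _ fun i _ => (isHomogeneous_X ℝ (some i)).pow 2)

omit [DecidableEq σ] in
/-- The complexified form at a complex point. [folklore] -/
private theorem eval_map_lorentzForm (w : Option σ → ℂ) :
    eval w (map (algebraMap ℝ ℂ) (lorentzForm σ)) = w none ^ 2 - ∑ i, w (some i) ^ 2 := by
  simp [lorentzForm, map_sum]

/-- A complex number whose square is a nonnegative real is real. [folklore] -/
private theorem im_eq_zero_of_sq_eq_ofReal {a : ℂ} {r : ℝ} (hr : 0 ≤ r) (h : a ^ 2 = (r : ℂ)) :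
    a.im = 0 := by
  have hre := congrArg Complex.re h
  have him := congrArg Complex.im h
  simp only [sq, Complex.mul_re, Complex.mul_im, Complex.ofReal_re, Complex.ofReal_im] at hre him
  by_contra hne
  have hare : a.re = 0 := by
    have : 2 * a.re * a.im = 0 := by linarith
    rcases mul_eq_zero.1 this with h2 | h2
    · rcases mul_eq_zero.1 h2 with h3 | h3
      · norm_num at h3
      · exact h3
    · exact absurd h2 hne
  rw [hare] at hre
  have : a.im * a.im = -r := by linarith
  have h2 : 0 < a.im * a.im := mul_self_pos.2 hne
  linarith

omit [Fintype σ] in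
/-- The point `x + t e₀`: coordinates. [folklore] -/
private theorem add_smul_single_none (x : Option σ → ℝ) (t : ℝ) :
    (x + t • (Pi.single none 1 : Option σ → ℝ)) none = x none + t ∧
      ∀ i, (x + t • (Pi.single none 1 : Option σ → ℝ)) (some i) = x (some i) := by
  classical
  refine ⟨by simp, fun i => by simp⟩

/-- **Borcea–Brändén–Liggett §4.1 (II): the Lorentz form is hyperbolic with respect to `e₀ = (1, 0, …, 0)`**
(`p(e₀) = 1`, and `(x₀ + z)² = Σ xᵢ² ≥ 0` forces `z ∈ ℝ`). [cite: BorceaBrandenLiggett2007, §4.1 example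
(II)] [cite: Guler1997, §2] -/
theorem isHyperbolic_lorentzForm : IsHyperbolic (lorentzForm σ) (Pi.single none 1) := by
  classical
  refine ⟨?_, fun x z hz => ?_⟩
  · rw [eval_lorentzForm]
    simp
  · rw [eval_map_lorentzForm] at hz
    simp only [Pi.single_apply, Option.some_ne_none, if_false, if_true, Complex.ofReal_one, mul_one,
      Complex.ofReal_zero, mul_zero, add_zero] at hz
    have hsq : ((x none : ℂ) + z) ^ 2 = ((∑ i, x (some i) ^ 2 : ℝ) : ℂ) := by
      rw [sub_eq_zero] at hz
      rw [hz]
      push_cast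
      rfl
    have him := im_eq_zero_of_sq_eq_ofReal (Finset.sum_nonneg fun i _ => sq_nonneg (x (some i))) hsq
    simpa using him

/-- **The open hyperbolicity cone of the Lorentz form is the open Lorentz cone**
`{x | √(Σ xᵢ²) < x₀}` (the tree's `openHyperbolicityCone` is BBL's `C_e(p)`; a point with
`√(Σ xᵢ²) = x₀` is a zero of `p`). [cite: BorceaBrandenLiggett2007, §4.1 example (II)] [cite: Guler1997, §2] -/
theorem openHyperbolicityCone_lorentzForm :
    openHyperbolicityCone (lorentzForm σ) (Pi.single none 1) =
      {x | Real.sqrt (∑ i, x (some i) ^ 2) < x none} := by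
  classical
  ext x
  set S : ℝ := ∑ i, x (some i) ^ 2 with hS
  have hS0 : 0 ≤ S := Finset.sum_nonneg fun i _ => sq_nonneg (x (some i))
  simp only [mem_openHyperbolicityCone_iff, Set.mem_setOf_eq]
  constructor
  · intro h
    by_contra hle
    push Not at hle
    have h0 := h (Real.sqrt S - x none) (by linarith)
    rw [eval_lorentzForm] at h0
    apply h0
    simp only [(add_smul_single_none x _).1, (add_smul_single_none x _).2, add_sub_cancel,
      Real.sq_sqrt hS0, ← hS, sub_self]
  · intro h τ hτ
    rw [eval_lorentzForm]
    simp only [(add_smul_single_none x τ).1, (add_smul_single_none x τ).2, ← hS]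
    have hx0 : 0 ≤ x none := (Real.sqrt_nonneg S).trans h.le
    have h1 : S < (x none + τ) ^ 2 := by
      calc S = Real.sqrt S ^ 2 := (Real.sq_sqrt hS0).symm
        _ < (x none + τ) ^ 2 := by
          apply pow_lt_pow_left₀ (by linarith) (Real.sqrt_nonneg S) two_ne_zero
    linarith

/-- **The closed hyperbolicity cone of the Lorentz form is the Lorentz cone as printed**,
`Λ₊ = {x | √(Σ xᵢ²) ≤ x₀}`. [cite: BorceaBrandenLiggett2007, §4.1 example (II)] -/
theorem hyperbolicityCone_lorentzForm :
    hyperbolicityCone (lorentzForm σ) (Pi.single none 1) =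
      {x | Real.sqrt (∑ i, x (some i) ^ 2) ≤ x none} := by
  classical
  ext x
  set S : ℝ := ∑ i, x (some i) ^ 2 with hS
  have hS0 : 0 ≤ S := Finset.sum_nonneg fun i _ => sq_nonneg (x (some i))
  simp only [mem_hyperbolicityCone_iff, Set.mem_setOf_eq]
  constructor
  · intro h
    by_contra hlt
    push Not at hlt
    have h0 := h (Real.sqrt S - x none) (by linarith)
    rw [eval_lorentzForm] at h0
    apply h0
    simp only [(add_smul_single_none x _).1, (add_smul_single_none x _).2, add_sub_cancel,
      Real.sq_sqrt hS0, ← hS, sub_self]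
  · intro h τ hτ
    rw [eval_lorentzForm]
    simp only [(add_smul_single_none x τ).1, (add_smul_single_none x τ).2, ← hS]
    have h1 : S < (x none + τ) ^ 2 := by
      calc S = Real.sqrt S ^ 2 := (Real.sq_sqrt hS0).symm
        _ < (x none + τ) ^ 2 := by
          apply pow_lt_pow_left₀ (by linarith) (Real.sqrt_nonneg S) two_ne_zero
    linarith

end Literature.AlgebraicGeometry.HyperbolicPolynomials
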